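import Literature.Analysis.Matrix.ConjugateGradientConvergence
import Mathlib.Algebra.Polynomial.FieldDivision
import Mathlib.Algebra.Algebra.Spectrum.Basic
import Mathlib.Analysis.Matrix.Spectrum
import HarnessLib

/-!
# Krylov space solvers for shifted linear systems ("many masses on one stroke")

The structural facts behind the multi-shift (multi-mass) conjugate gradient solver CG-M: for a
family of shifted systems `(A + σ) x = b` with a common right-hand side and ZERO initial guess,
one Krylov space serves every shift, the Galerkin (CG / Lanczos–FOM) residuals of all shifted
systems are collinear with the seed residual, the proportionality factor is `ζ^σ_m = 1/p_m(−σ)`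
(`p_m` the seed residual polynomial), and — for `A` symmetric positive definite and `σ ≥ 0` — the
seed's `√κ` convergence bound holds for every shifted system.  Sequel to
`ConjugateGradientConvergence.lean`, whose Galerkin–Krylov iterate `IsCGIterate` and Krylov space
`krylov` are reused verbatim (real symmetric matrices, Euclidean Galerkin condition).

Sources (held texts, read for this file).
* B. Jegerlehner, *Krylov space solvers for shifted linear systems*, arXiv:hep-lat/9612014 (1996)
  [Jegerlehner1996] (`paper:arxiv-hep-lat_9612014`, TeX-derived text without printed equation
  numbers — displays are cited by section and CONTENT).  §1: "(A+σ) x − b = 0 has to be calculated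
  for a whole set of values of σ … using only as many matrix-vector operations as the solution of
  the most difficult single system requires"; "shifted polynomials, defined by
  `P^σ_n(A+σ) = c P_n(A)`".  §2: "`𝒦_n(A, v₀) = span{Aⁱ v₀, i = 0 … n−1}`", "The Lanczos polynomials
  `Z_n(z)` have the property of formal orthogonality, namely `Z_n(A) v₀ ⊥ 𝒦_n(A, v₀)` … usually
  `Z_n(z)` is uniquely determined up to a scalar constant … Since `𝒦_n(A, v₀) = 𝒦_n(A+σ, v₀)`, we
  must have `Z^σ_n(z+σ) = ζ^σ_n Z_n(z)`, since `Z^σ_n(z+σ)` is a formally orthogonal polynomial for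
  `A` as well"; "`c_n^σ` is determined by the normalization conditions for `P_n(z)` required in the
  algorithm".  §3.1 (CG-M): "Note that the initial guess has to be set to zero",
  "`x₀^σ = 0, r₀ = p₀^σ = b`", "`σ = 0` corresponds usually to the system with the slowest
  convergence"; §2.1: "the shifted polynomial converges better than the original polynomial …
  since we expect the condition number of the matrix `A+σ` to decrease for `σ > 0`".
* A. Frommer, B. Nöckel, S. Güsken, T. Lippert, K. Schilling, *Many masses on one stroke*,
  Int. J. Mod. Phys. C 6 (1995) 627 = hep-lat/9504020 [FrommerEtAl1995], §3: "the Lanczos vectors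
  … depend only on `D` but not on `σ`, provided one always has the same initial vector …
  `x_i^0 = 0` for `i = 1, …, l` leads to the same initial residual `r_i^0 = φ`".
* V. Simoncini, D. B. Szyld, *Recent computational developments in Krylov subspace methods for
  linear systems*, Numer. Linear Algebra Appl. 14 (2007) 1–59 [SimonciniSzyld2006]
  (`paper:doi-10-1002-nla-499`), §13.3 p. 35: "Due to the shift-invariance property of Krylov
  subspaces, i.e., it holds that `K_m(M, b) = K_m(M + σI, b)`"; §14.1 p. 37–38: "This allows one to
  obtain approximate solutions for all values of the parameter, by generating a single
  approximation space", "since in FOM the residual vector is a multiple of `v_{m+1}` (cf. (2.30)),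
  the residuals of all shifted systems are naturally collinear", and (Frommer–Glässner) "the nonseed
  residual `r_m = p̂(A − σI) r₀` is obtained, with `p̂(λ) = p(λ + σ)/p(σ)`, where `p` is the …
  residual polynomial associated with the seed system … `p̂(λ)` is defined only if `p(σ) ≠ 0`"
  (their shift is `A − σI`; here, as in the lattice papers, `A + σ`).
* Y. Saad, *Iterative Methods for Sparse Linear Systems*, 2nd ed. (2003) [Saad2003], §6.2
  Proposition 6.1 ("Let `μ` be the grade of `v`. Then `𝒦_μ` is invariant under `A` and `𝒦_m = 𝒦_μ`
  for all `m ≥ μ`") and Proposition 6.2 with its proof ("`v, Av, …, A^{m−1}v` form a basis of `𝒦_m`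
  iff … the only polynomial of degree not exceeding `m−1` for which `p(A)v = 0` is the zero
  polynomial"), p0182 of the held text.

The results (all proved; no named facts; `A : Matrix ι ι ℝ`, shifts `A + σ • 1`):
* §1 `krylov_add_smul_one` — SHIFT INVARIANCE `𝒦_m(A + σ, v) = 𝒦_m(A, v)`.
* §2 `isCGIterate_add_smul_one_iff`, `IsCGIterate.mem_krylov_of_shift` — with zero initial guess the
  `m`-th Galerkin iterate of EVERY shifted system lies in the one space `𝒦_m(A, b)` (generated by
  `m − 1` products with `A`) and is characterised there by `b − (A+σ)x ⊥ 𝒦_m(A, b)`: the shifted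
  solves need no matrix–vector products of their own.
* §3 `IsCGIterate.exists_residual_eq_aeval`, `IsCGIterate.residual_mem_krylov_succ` — the residual is
  `p(A) r₀` with `deg p ≤ m`, `p(0) = 1`, hence lies in `𝒦_{m+1}(A, r₀)` (and is `⊥ 𝒦_m` by the
  Galerkin condition).
* §4 `krylov_succ`, `exists_eq_smul_of_mem_krylov_succ` — `𝒦_{m+1} = 𝒦_m + ℝ A^m v`, and the
  vectors of `𝒦_{m+1}` orthogonal to `𝒦_m` form a line ("`Z_n` is uniquely determined up to a
  scalar constant"); `krylov_le_of_aeval_mulVec_eq_zero` — Saad's Proposition 6.1 (a vanishing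
  `p(A)v`, `p ≠ 0`, `deg p ≤ m`, saturates the Krylov sequence at `𝒦_m`).
* §5 `IsCGIterate.exists_shifted_residual_eq_smul` — COLLINEAR RESIDUALS: for the seed iterate `x`
  and the shifted iterate `x'` (both from `x₀ = 0`), `b − (A+σ)x' = ζ (b − A x)` for some real `ζ`
  (unconditionally: if the seed residual vanishes, so does every shifted one).
* §6 `eq_zero_of_aeval_mulVec_eq_zero` (Saad Prop. 6.2: no breakdown ⇒ the residual polynomial is
  unique), `IsCGIterate.shifted_residual_eq_inv_eval_smul` — `ζ^σ_m = 1/p_m(−σ)` with `p_m(−σ) ≠ 0`,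
  i.e. the shifted residual polynomial is `p_m(· − σ)/p_m(−σ)`.
* §7 `posDef_add_smul_one`, `eigenvalues_add_smul_one_mem_Icc`, `sqrtRate_mono`,
  `IsCGIterate.aNorm_le_geometric_of_shift` — for `A` symmetric positive definite with spectrum in
  `[α, β] ⊂ (0, ∞)` and `σ ≥ 0`, `A + σ` is positive definite with spectrum in `[α+σ, β+σ]`, its
  condition number is at most `κ = β/α`, and the `m`-th Galerkin iterate of the shifted system obeys
  the SEED bound `‖x'_* − x'_m‖_{A+σ} ≤ 2((√κ − 1)/(√κ + 1))^m ‖x'_* − x₀‖_{A+σ}` (Saad (6.128) for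
  the shifted system, weakened to the unshifted `κ`).

What is deliberately NOT here: the CG-M recursions for `β^σ_n, α^σ_n, ζ^σ_{n+1}` (Jegerlehner §2.3,
§3.1) — like the parent file, everything is stated for the Galerkin iterate, not for an algorithm
computing it; the statement that the actual factors satisfy `0 < ζ^σ_m ≤ 1` for `σ ≥ 0` (it follows
from the roots of `p_m` being Ritz values in `[λ_min, λ_max]`, a Lanczos fact the tree does not yet
have) — §7 is the bound-level version only; BiCG/BiCGstab/QMR/MR-M and non-symmetric `A`; complex
Hermitian matrices (`TODO(general form)`: the parent's `krylov`/`IsCGIterate` are real); the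
`DD† = AA† + m²` staggered structure and even–odd/`γ₅` tricks of the lattice papers; finite
precision.

## References
* [Jegerlehner1996] B. Jegerlehner, Krylov space solvers for shifted linear systems,
  hep-lat/9612014, §1, §2, §2.1, §3.1.
* [FrommerEtAl1995] A. Frommer et al., Many masses on one stroke, IJMPC 6 (1995) 627, §3.
* [SimonciniSzyld2006] V. Simoncini, D. B. Szyld, NLAA 14 (2007) 1–59, §2.5 (2.30), §13.3, §14.1.
* [Saad2003] Y. Saad, Iterative Methods for Sparse Linear Systems, §6.2 Propositions 6.1–6.2;
  §6.11.3 Theorem 6.29 (6.128) (through the parent file).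
-/

noncomputable section

open scoped Matrix
open Finset Polynomial

namespace Literature.Analysis.Matrix

namespace ConjugateGradient

open _root_.Matrix

variable {ι : Type*} [Fintype ι] [DecidableEq ι]

/-! ### §1 Shift invariance of Krylov subspaces -/

/-- **A polynomial in the shifted matrix is a polynomial in `A`**: `q(A + σ) = (q ∘ (X + σ))(A)`
(the "shifted polynomial" bookkeeping `P^σ_n(z + σ) = c^σ_n P_n(z)` lives on this identity).
[cite: Jegerlehner1996, §2 (display "P_n^σ(z+σ) = c_n^σ P_n(z)")] -/
theorem aeval_add_smul_one (A : Matrix ι ι ℝ) (σ : ℝ) (q : ℝ[X]) :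
    aeval (A + σ • (1 : Matrix ι ι ℝ)) q = aeval A (q.comp (X + C σ)) := by
  rw [aeval_comp, map_add, aeval_X, aeval_C, Algebra.algebraMap_eq_smul_one]

/-- **Shift invariance, one inclusion**: `𝒦_m(A + σ, v) ≤ 𝒦_m(A, v)` — `(A + σ)^j v` is a
polynomial of degree `j` in `A` applied to `v`.
[cite: Jegerlehner1996, §2 (display "𝒦_n(A, v₀) = 𝒦_n(A+σ, v₀)")] -/
theorem krylov_add_smul_one_le (A : Matrix ι ι ℝ) (σ : ℝ) (v : ι → ℝ) (m : ℕ) :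
    krylov (A + σ • 1) v m ≤ krylov A v m := by
  refine Submodule.span_le.mpr ?_
  rintro _ ⟨j, rfl⟩
  have h : (A + σ • (1 : Matrix ι ι ℝ)) ^ (j : ℕ) = aeval A ((X + C σ) ^ (j : ℕ)) := by
    rw [map_pow, map_add, aeval_X, aeval_C, Algebra.algebraMap_eq_smul_one]
  show (A + σ • (1 : Matrix ι ι ℝ)) ^ (j : ℕ) *ᵥ v ∈ krylov A v m
  rw [h]
  refine aeval_mulVec_mem_krylov (lt_of_le_of_lt degree_le_natDegree ?_)
  rw [natDegree_pow, natDegree_X_add_C, mul_one]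
  exact_mod_cast j.isLt

/-- **Shift invariance of Krylov subspaces**: `𝒦_m(A + σ, v) = 𝒦_m(A, v)` for every real shift
`σ` — "the space generated by `A` is the same as that generated by `M`", the reason one basis /
one set of matrix–vector products serves all shifted systems.
[cite: Jegerlehner1996, §2 (display "𝒦_n(A, v₀) = 𝒦_n(A+σ, v₀)"); SimonciniSzyld2006, §13.3
("K_m(M, b) = K_m(M + σI, b)")] -/
theorem krylov_add_smul_one (A : Matrix ι ι ℝ) (σ : ℝ) (v : ι → ℝ) (m : ℕ) :
    krylov (A + σ • 1) v m = krylov A v m := by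
  refine le_antisymm (krylov_add_smul_one_le A σ v m) ?_
  have h := krylov_add_smul_one_le (A + σ • 1) (-σ) v m
  rwa [add_assoc, ← add_smul, add_neg_cancel, zero_smul, add_zero] at h

/-! ### §2 Zero initial guess: every shifted Galerkin iterate lives in `𝒦_m(A, b)` -/

omit [DecidableEq ι] in
/-- With zero initial guess the initial residual of EVERY shifted system is the common right-hand
side: `b − (A + σ)·0 = b` ("`x₀^σ = 0, r₀ = b`"; "`x_i^0 = 0 … leads to the same initial residual
`r_i^0 = φ`"). [cite: Jegerlehner1996, §3.1 (CG-M: "the initial guess has to be set to zero");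
FrommerEtAl1995, §3] -/
theorem residual_zero (B : Matrix ι ι ℝ) (b : ι → ℝ) : b - B *ᵥ 0 = b := by
  rw [mulVec_zero, sub_zero]

/-- **All shifted systems in one Krylov space.**  With `x₀ = 0`, `x` is the `m`-th Galerkin (CG)
iterate of the shifted system `(A + σ) x = b` iff `x ∈ 𝒦_m(A, b)` — the UNSHIFTED space, built from
`b` with `m − 1` products by `A` — and `b − (A + σ) x ⊥ 𝒦_m(A, b)`.  So the iterates for a whole set
of shifts are obtained "using only as many matrix-vector operations as the solution of a single
system requires". [cite: Jegerlehner1996, §1–§2 (displays "(A+σ) x − b = 0",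
"𝒦_n(A, v₀) = 𝒦_n(A+σ, v₀)"); SimonciniSzyld2006, §14.1 ("approximate solutions for all values of
the parameter, by generating a single approximation space")] -/
theorem isCGIterate_add_smul_one_iff {A : Matrix ι ι ℝ} {σ : ℝ} {b x : ι → ℝ} {m : ℕ} :
    IsCGIterate (A + σ • 1) b 0 m x ↔
      x ∈ krylov A b m ∧ ∀ w ∈ krylov A b m, w ⬝ᵥ (b - (A + σ • 1) *ᵥ x) = 0 := by
  constructor
  · rintro ⟨hK, hG⟩
    rw [residual_zero, krylov_add_smul_one] at hK hG
    rw [sub_zero] at hK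
    exact ⟨hK, hG⟩
  · rintro ⟨hK, hG⟩
    refine ⟨?_, ?_⟩
    · rw [residual_zero, krylov_add_smul_one, sub_zero]
      exact hK
    · rw [residual_zero, krylov_add_smul_one]
      exact hG

/-- The `m`-th Galerkin iterate of ANY shifted system (zero initial guess) lies in the seed space
`𝒦_m(A, b)`: no matrix–vector products with `A + σ` are needed to represent it.
[cite: Jegerlehner1996, §2 ("we can construct solvers which generate iterates … without additional
matrix-vector products for multiple values of σ")] -/
theorem IsCGIterate.mem_krylov_of_shift {A : Matrix ι ι ℝ} {σ : ℝ} {b x : ι → ℝ} {m : ℕ}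
    (hx : IsCGIterate (A + σ • 1) b 0 m x) : x ∈ krylov A b m :=
  (isCGIterate_add_smul_one_iff.mp hx).1

/-- Existence for every shift `σ ≥ 0` when `A` is symmetric positive definite (the parent file's
Proposition 5.1 (i) applied to the positive definite `A + σ`). [cite: Saad2003, Proposition 5.1 (i);
Jegerlehner1996, §3.1 (CG-M)] -/
theorem exists_isCGIterate_add_smul_one {A : Matrix ι ι ℝ} (hA : A.PosDef) {σ : ℝ} (hσ : 0 ≤ σ)
    (b : ι → ℝ) (m : ℕ) : ∃ x, IsCGIterate (A + σ • 1) b 0 m x :=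
  exists_isCGIterate (hA.add_posSemidef (Matrix.PosSemidef.one.smul hσ)) b 0 m

/-! ### §3 The residual of a Galerkin iterate: `r_m = p_m(A) r₀ ∈ 𝒦_{m+1}`, `r_m ⊥ 𝒦_m` -/

/-- **The residual polynomial**: the residual of the `m`-th Galerkin iterate is `p(A) r₀` for a
polynomial `p` with `deg p ≤ m` and `p(0) = 1` (namely `p = 1 − X q` where `x − x₀ = q(A) r₀`) —
"residuals or iterates which are … derived from polynomials `P_n(z)` of the matrix: `v_n = P_n(A) v₀`".
[cite: Jegerlehner1996, §2 (display "v_n = P_n(A) v_0"); Saad2003, §6.11.3 Lemma 6.28] -/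
theorem IsCGIterate.exists_residual_eq_aeval {A : Matrix ι ι ℝ} {b x₀ x : ι → ℝ} {m : ℕ}
    (hx : IsCGIterate A b x₀ m x) :
    ∃ p : ℝ[X], p.natDegree ≤ m ∧ p.eval 0 = 1 ∧ b - A *ᵥ x = aeval A p *ᵥ (b - A *ᵥ x₀) := by
  obtain ⟨q, hqdeg, hq⟩ := mem_krylov_iff.mp hx.mem_krylov
  refine ⟨1 - X * q, ?_, by simp, ?_⟩
  · refine (natDegree_sub_le _ _).trans ?_
    rw [natDegree_one, Nat.zero_max]
    by_cases hq0 : q = 0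
    · simp [hq0]
    · have hqn : q.natDegree < m := by
        have := hqdeg
        rwa [degree_eq_natDegree hq0, Nat.cast_lt] at this
      calc (X * q).natDegree ≤ X.natDegree + q.natDegree := natDegree_mul_le
        _ ≤ 1 + q.natDegree := by gcongr; exact natDegree_X_le
        _ ≤ m := by omega
  · have hsplit : b - A *ᵥ x = (b - A *ᵥ x₀) - A *ᵥ (x - x₀) := by rw [mulVec_sub]; abel
    rw [hsplit, ← hq, map_sub, map_one, map_mul, aeval_X, sub_mulVec, one_mulVec, ← mulVec_mulVec]

/-- **`r_m ∈ 𝒦_{m+1}(A, r₀)`**: the residual of the `m`-th Galerkin iterate is a polynomial of degree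
`≤ m` in `A` applied to `r₀` (and it is orthogonal to `𝒦_m(A, r₀)` by `IsCGIterate.galerkin` —
"`Z_n(A) v₀ ⊥ 𝒦_n(A, v₀)`"). [cite: Jegerlehner1996, §2 (display "Z_n(A) v_0 ⊥ 𝒦_n(A, v_0)");
SimonciniSzyld2006, §2.5 eq. (2.30)] -/
theorem IsCGIterate.residual_mem_krylov_succ {A : Matrix ι ι ℝ} {b x₀ x : ι → ℝ} {m : ℕ}
    (hx : IsCGIterate A b x₀ m x) : b - A *ᵥ x ∈ krylov A (b - A *ᵥ x₀) (m + 1) := by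
  obtain ⟨p, hpdeg, -, hp⟩ := hx.exists_residual_eq_aeval
  rw [hp]
  refine aeval_mulVec_mem_krylov (lt_of_le_of_lt degree_le_natDegree ?_)
  exact_mod_cast Nat.lt_succ_of_le hpdeg

/-! ### §4 The line `𝒦_{m+1} ⊖ 𝒦_m` and Krylov saturation -/

/-- **`𝒦_{m+1}(A, v) = 𝒦_m(A, v) + ℝ·A^m v`.** [cite: Saad2003, §6.2 eq. (6.2)] -/
theorem krylov_succ (A : Matrix ι ι ℝ) (v : ι → ℝ) (m : ℕ) :
    krylov A v (m + 1) = krylov A v m ⊔ ℝ ∙ ((A ^ m) *ᵥ v) := by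
  apply le_antisymm
  · refine Submodule.span_le.mpr ?_
    rintro _ ⟨j, rfl⟩
    show (A ^ (j : ℕ)) *ᵥ v ∈ krylov A v m ⊔ ℝ ∙ ((A ^ m) *ᵥ v)
    rcases lt_or_eq_of_le (Nat.lt_succ_iff.mp j.isLt) with hj | hj
    · exact Submodule.mem_sup_left (Submodule.subset_span ⟨⟨j, hj⟩, rfl⟩)
    · rw [hj]
      exact Submodule.mem_sup_right (Submodule.mem_span_singleton_self _)
  · refine sup_le (krylov_mono A v (Nat.le_succ m)) ?_
    rw [Submodule.span_singleton_le_iff_mem]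
    exact Submodule.subset_span ⟨⟨m, Nat.lt_succ_self m⟩, rfl⟩

omit [DecidableEq ι] in
/-- A vector of a subspace that is orthogonal to that subspace is zero (Euclidean inner product).
[folklore] -/
private theorem eq_zero_of_mem_of_orthogonal {K : Submodule ℝ (ι → ℝ)} {w : ι → ℝ} (hw : w ∈ K)
    (horth : ∀ u ∈ K, u ⬝ᵥ w = 0) : w = 0 :=
  dotProduct_self_eq_zero.mp (horth w hw)

/-- **"`Z_n` is uniquely determined up to a scalar constant"**: two vectors of `𝒦_{m+1}(A, v)` that
are both orthogonal to `𝒦_m(A, v)` are collinear — the first one being nonzero, the second is a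
real multiple of it.  (Write `u = k + a A^m v`, `u' = k' + a' A^m v` with `k, k' ∈ 𝒦_m`; then
`a'u − a u' ∈ 𝒦_m` is orthogonal to `𝒦_m`, hence zero, and `a ≠ 0` since `u ∉ 𝒦_m`.)
[cite: Jegerlehner1996, §2 ("Z_n(z) is uniquely determined up to a scalar constant");
SimonciniSzyld2006, §2.5 eq. (2.30) ("the residual vector is a multiple of v_{m+1}")] -/
theorem exists_eq_smul_of_mem_krylov_succ {A : Matrix ι ι ℝ} {v u u' : ι → ℝ} {m : ℕ}
    (hu : u ∈ krylov A v (m + 1)) (hou : ∀ w ∈ krylov A v m, w ⬝ᵥ u = 0) (hne : u ≠ 0)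
    (hu' : u' ∈ krylov A v (m + 1)) (hou' : ∀ w ∈ krylov A v m, w ⬝ᵥ u' = 0) :
    ∃ c : ℝ, u' = c • u := by
  rw [krylov_succ] at hu hu'
  obtain ⟨k, hk, t, ht, rfl⟩ := Submodule.mem_sup.mp hu
  obtain ⟨k', hk', t', ht', rfl⟩ := Submodule.mem_sup.mp hu'
  obtain ⟨a, rfl⟩ := Submodule.mem_span_singleton.mp ht
  obtain ⟨a', rfl⟩ := Submodule.mem_span_singleton.mp ht'
  -- `a' u − a u' = a' k − a k' ∈ 𝒦_m` is orthogonal to `𝒦_m`, hence zero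
  have hzero : a' • (k + a • ((A ^ m) *ᵥ v)) - a • (k' + a' • ((A ^ m) *ᵥ v)) = 0 := by
    refine eq_zero_of_mem_of_orthogonal (K := krylov A v m) ?_ ?_
    · have : a' • (k + a • ((A ^ m) *ᵥ v)) - a • (k' + a' • ((A ^ m) *ᵥ v)) = a' • k - a • k' := by
        simp only [smul_add, smul_smul, mul_comm a' a]
        abel
      rw [this]
      exact Submodule.sub_mem _ (Submodule.smul_mem _ _ hk) (Submodule.smul_mem _ _ hk')
    · intro w hw
      rw [dotProduct_sub, dotProduct_smul, dotProduct_smul, hou w hw, hou' w hw, smul_zero,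
        smul_zero, sub_zero]
  -- `a ≠ 0`: otherwise `u = k ∈ 𝒦_m` would be orthogonal to itself
  have ha : a ≠ 0 := by
    rintro rfl
    apply hne
    refine eq_zero_of_mem_of_orthogonal (K := krylov A v m) ?_ hou
    simpa using hk
  have h : a • (k' + a' • ((A ^ m) *ᵥ v)) = a' • (k + a • ((A ^ m) *ᵥ v)) :=
    (sub_eq_zero.mp hzero).symm
  refine ⟨a⁻¹ * a', ?_⟩
  calc k' + a' • ((A ^ m) *ᵥ v)
      = a⁻¹ • (a • (k' + a' • ((A ^ m) *ᵥ v))) := by rw [smul_smul, inv_mul_cancel₀ ha, one_smul]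
    _ = (a⁻¹ * a') • (k + a • ((A ^ m) *ᵥ v)) := by rw [h, smul_smul]

/-- **Krylov saturation** (Saad's Proposition 6.1, "`𝒦_m = 𝒦_μ` for all `m ≥ μ`, `μ` the grade of
`v`", in the form used here): if `p(A) v = 0` for a NONZERO polynomial `p` of degree `≤ m`, then
`𝒦_n(A, v) ≤ 𝒦_m(A, v)` for every `n` — divide `q = s·p + (q mod p)` and note `q(A)v = (q mod p)(A)v`
with `deg (q mod p) < deg p ≤ m`. [cite: Saad2003, §6.2 Proposition 6.1] -/
theorem krylov_le_of_aeval_mulVec_eq_zero {A : Matrix ι ι ℝ} {v : ι → ℝ} {p : ℝ[X]} {m : ℕ}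
    (hp : p ≠ 0) (hpdeg : p.natDegree ≤ m) (hpv : aeval A p *ᵥ v = 0) (n : ℕ) :
    krylov A v n ≤ krylov A v m := by
  intro y hy
  obtain ⟨q, -, rfl⟩ := mem_krylov_iff.mp hy
  have hdiv : q = q / p * p + q % p := by
    rw [mul_comm]
    exact (EuclideanDomain.div_add_mod q p).symm
  have hdeg : (q % p).degree < m :=
    lt_of_lt_of_le (degree_mod_lt q hp) (degree_le_of_natDegree_le hpdeg)
  rw [hdiv, map_add, map_mul, add_mulVec, ← mulVec_mulVec, hpv, mulVec_zero, zero_add]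
  exact aeval_mulVec_mem_krylov hdeg

/-! ### §5 Collinear residuals: `r^σ_m = ζ^σ_m r_m` -/

/-- **Collinearity of the shifted Galerkin (CG-M / Lanczos) residuals.**  Let `x` be the `m`-th
Galerkin iterate of the seed system `A x = b` and `x'` that of the shifted system `(A + σ) x' = b`,
both from the zero initial guess.  Then the shifted residual is a real multiple of the seed
residual: `b − (A + σ) x' = ζ · (b − A x)` — "`Z^σ_n(z+σ) = ζ^σ_n Z_n(z)`, since `Z^σ_n(z+σ)` is a
formally orthogonal polynomial for `A` as well"; "the residuals of all shifted systems are naturally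
collinear".  Proof: both residuals lie in `𝒦_{m+1}(A, b) = 𝒦_{m+1}(A+σ, b)` and are orthogonal to
`𝒦_m(A, b) = 𝒦_m(A+σ, b)` (§1, §3), and that set is a line (§4); if the seed residual vanishes, its
residual polynomial annihilates `b`, the Krylov sequence saturates at `𝒦_m`, and the shifted residual
— in `𝒦_m` and orthogonal to it — vanishes too.  No hypothesis on `A` or `σ`.
[cite: Jegerlehner1996, §2 (display "Z^σ_n(z+σ) = ζ_n^σ Z_n(z)"); SimonciniSzyld2006, §14.1
("the residuals of all shifted systems are naturally collinear")] -/
theorem IsCGIterate.exists_shifted_residual_eq_smul {A : Matrix ι ι ℝ} {σ : ℝ} {b x x' : ι → ℝ}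
    {m : ℕ} (hx : IsCGIterate A b 0 m x) (hx' : IsCGIterate (A + σ • 1) b 0 m x') :
    ∃ ζ : ℝ, b - (A + σ • 1) *ᵥ x' = ζ • (b - A *ᵥ x) := by
  -- the seed residual: in `𝒦_{m+1}(A, b)`, orthogonal to `𝒦_m(A, b)`
  have hr : b - A *ᵥ x ∈ krylov A b (m + 1) := by
    simpa only [residual_zero] using hx.residual_mem_krylov_succ
  have hro : ∀ w ∈ krylov A b m, w ⬝ᵥ (b - A *ᵥ x) = 0 := by
    simpa only [residual_zero] using hx.galerkin
  -- the shifted residual: in `𝒦_{m+1}(A+σ, b) = 𝒦_{m+1}(A, b)`, orthogonal to `𝒦_m(A+σ, b) = 𝒦_m(A, b)`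
  have hr' : b - (A + σ • 1) *ᵥ x' ∈ krylov A b (m + 1) := by
    simpa only [residual_zero, krylov_add_smul_one] using hx'.residual_mem_krylov_succ
  have hro' : ∀ w ∈ krylov A b m, w ⬝ᵥ (b - (A + σ • 1) *ᵥ x') = 0 := by
    simpa only [residual_zero, krylov_add_smul_one] using hx'.galerkin
  by_cases hne : b - A *ᵥ x = 0
  · -- the seed system has converged: `p(A) b = 0` with `p(0) = 1`, so `𝒦_{m+1}(A, b) ≤ 𝒦_m(A, b)`
    obtain ⟨p, hpdeg, hp0, hp⟩ := hx.exists_residual_eq_aeval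
    rw [residual_zero, hne] at hp
    have hpne : p ≠ 0 := by
      rintro rfl
      simp at hp0
    have hK := krylov_le_of_aeval_mulVec_eq_zero hpne hpdeg hp.symm (m + 1)
    refine ⟨0, ?_⟩
    rw [hne, smul_zero]
    exact eq_zero_of_mem_of_orthogonal (hK hr') hro'
  · exact exists_eq_smul_of_mem_krylov_succ hr hro hne hr' hro'

/-! ### §6 The factor: `ζ^σ_m = 1/p_m(−σ)` -/

/-- **No breakdown ⇒ the residual polynomial is unique** (Saad's Proposition 6.2, proof:
"`v, Av, …, A^m v` form a basis of `𝒦_{m+1}` iff … the only polynomial of degree not exceeding `m`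
for which `p(A)v = 0` is the zero polynomial"): if `b, Ab, …, A^m b` are linearly independent and
`p(A) b = 0` with `deg p ≤ m`, then `p = 0`. [cite: Saad2003, §6.2 Proposition 6.2 (proof)] -/
theorem eq_zero_of_aeval_mulVec_eq_zero {A : Matrix ι ι ℝ} {b : ι → ℝ} {m : ℕ}
    (hind : LinearIndependent ℝ (fun j : Fin (m + 1) => (A ^ (j : ℕ)) *ᵥ b)) {p : ℝ[X]}
    (hpdeg : p.natDegree ≤ m) (hp : aeval A p *ᵥ b = 0) : p = 0 := by
  have hsum : aeval A p *ᵥ b = ∑ j : Fin (m + 1), p.coeff j • ((A ^ (j : ℕ)) *ᵥ b) := by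
    rw [aeval_eq_sum_range' (Nat.lt_succ_of_le hpdeg), sum_mulVec,
      Finset.sum_range (fun i => (p.coeff i • A ^ i) *ᵥ b)]
    simp only [smul_mulVec]
  rw [hsum] at hp
  have hcoeff := Fintype.linearIndependent_iff.mp hind (fun j => p.coeff j) hp
  ext n
  rw [coeff_zero]
  by_cases hn : n ≤ m
  · exact hcoeff ⟨n, Nat.lt_succ_of_le hn⟩
  · exact coeff_eq_zero_of_natDegree_lt (lt_of_le_of_lt hpdeg (not_le.mp hn))

/-- **`ζ^σ_m = 1/p_m(−σ)`.**  In the no-breakdown regime (`b, Ab, …, A^m b` linearly independent),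
if the seed residual is `b − A x = p(A) b` with `deg p ≤ m` (§3; then `p` is THE residual polynomial
and `p(0) = 1` automatically), then `p(−σ) ≠ 0` and
the shifted residual is EXACTLY `b − (A + σ) x' = p(−σ)⁻¹ · (b − A x)`; equivalently the shifted
residual polynomial is `p(· − σ)/p(−σ)` ("`P^σ_n(z+σ) = c^σ_n P_n(z)` … `c_n^σ` is determined by the
normalization conditions"; Frommer–Glässner's `p̂(λ) = p(λ+σ)/p(σ)` for the shift `A − σI`, "defined
only if `p(σ) ≠ 0`").  Proof: §5 gives `p'(X+σ)(A) b = ζ p(A) b` for the shifted residual polynomial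
`p'`; by uniqueness `p'(X + σ) = ζ p`; evaluate at `−σ`.
[cite: Jegerlehner1996, §2 (displays "P_n^σ(z+σ) = c_n^σ P_n(z)", "Z^σ_n(z+σ) = ζ_n^σ Z_n(z)");
SimonciniSzyld2006, §14.1 ("p̂(λ) = p(λ + σ)/p(σ) … defined only if p(σ) ≠ 0")] -/
theorem IsCGIterate.shifted_residual_eq_inv_eval_smul {A : Matrix ι ι ℝ} {σ : ℝ}
    {b x x' : ι → ℝ} {m : ℕ} (hx : IsCGIterate A b 0 m x) (hx' : IsCGIterate (A + σ • 1) b 0 m x')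
    (hind : LinearIndependent ℝ (fun j : Fin (m + 1) => (A ^ (j : ℕ)) *ᵥ b))
    {p : ℝ[X]} (hpdeg : p.natDegree ≤ m) (hp : b - A *ᵥ x = aeval A p *ᵥ b) :
    p.eval (-σ) ≠ 0 ∧ b - (A + σ • 1) *ᵥ x' = (p.eval (-σ))⁻¹ • (b - A *ᵥ x) := by
  obtain ⟨ζ, hζ⟩ := hx.exists_shifted_residual_eq_smul hx'
  obtain ⟨p', hp'deg, hp'0, hp'⟩ := hx'.exists_residual_eq_aeval
  rw [residual_zero, aeval_add_smul_one] at hp'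
  -- `p'(X + σ)(A) b = ζ p(A) b`, hence `p'(X + σ) = ζ p` by independence
  have hpoly : p'.comp (X + C σ) = ζ • p := by
    refine sub_eq_zero.mp (eq_zero_of_aeval_mulVec_eq_zero hind ?_ ?_)
    · refine (natDegree_sub_le _ _).trans (max_le ?_ ((natDegree_smul_le _ _).trans hpdeg))
      rw [natDegree_comp, natDegree_X_add_C, mul_one]
      exact hp'deg
    · rw [map_sub, sub_mulVec, ← hp', hζ, map_smul, smul_mulVec, ← hp, sub_self]
  -- evaluate at `−σ`: `1 = p'(0) = ζ · p(−σ)`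
  have heval := congr_arg (eval (-σ)) hpoly
  rw [eval_comp, eval_add, eval_X, eval_C, neg_add_cancel, hp'0, eval_smul, smul_eq_mul] at heval
  have hne : p.eval (-σ) ≠ 0 := by
    intro h0
    rw [h0, mul_zero] at heval
    exact one_ne_zero heval
  exact ⟨hne, by rw [hζ, eq_inv_of_mul_eq_one_left heval.symm]⟩

/-! ### §7 Positive shifts: `A + σ` is better conditioned, the seed bound covers every shift -/

omit [Fintype ι] in
/-- For `A` symmetric positive definite and `σ ≥ 0`, the shifted matrix `A + σ` is symmetric
positive definite (each shifted system is again a CG problem). [cite: Jegerlehner1996, §3.1 (CG-M)] -/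
theorem posDef_add_smul_one {A : Matrix ι ι ℝ} (hA : A.PosDef) {σ : ℝ} (hσ : 0 ≤ σ) :
    (A + σ • (1 : Matrix ι ι ℝ)).PosDef :=
  hA.add_posSemidef (Matrix.PosSemidef.one.smul hσ)

/-- **The spectrum shifts rigidly**: if the eigenvalues of the symmetric matrix `A` lie in `[α, β]`,
those of `A + σ` lie in `[α + σ, β + σ]`. [cite: Jegerlehner1996, §2.1 ("we expect the condition
number of the matrix A+σ to decrease for σ>0"); SimonciniSzyld2006, §14.1 eq. (14.2)] -/
theorem eigenvalues_add_smul_one_mem_Icc {A : Matrix ι ι ℝ} (hA : A.IsHermitian) {σ α β : ℝ}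
    (hspec : ∀ i, hA.eigenvalues i ∈ Set.Icc α β)
    (hAσ : (A + σ • (1 : Matrix ι ι ℝ)).IsHermitian) (i : ι) :
    hAσ.eigenvalues i ∈ Set.Icc (α + σ) (β + σ) := by
  have hmem := hAσ.eigenvalues_mem_spectrum_real i
  -- `μ ∈ σ(A + σ)` iff `μ − σ ∈ σ(A)`
  have hmem' : (hAσ.eigenvalues i - σ) + σ ∈ spectrum ℝ (algebraMap ℝ (Matrix ι ι ℝ) σ + A) := by
    rw [Algebra.algebraMap_eq_smul_one, add_comm (σ • (1 : Matrix ι ι ℝ)) A, sub_add_cancel]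
    exact hmem
  rw [spectrum.add_mem_add_iff, hA.spectrum_real_eq_range_eigenvalues] at hmem'
  obtain ⟨j, hj⟩ := hmem'
  have hjb := hspec j
  rw [hj] at hjb
  exact ⟨by linarith [hjb.1], by linarith [hjb.2]⟩

/-- **A positive shift lowers the condition number**: `(β + σ)/(α + σ) ≤ β/α` for `0 < α ≤ β`,
`σ ≥ 0`. [cite: Jegerlehner1996, §2.1 ("the condition number of the matrix A+σ … decrease[s] for
σ>0")] -/
theorem div_add_le_div {α β σ : ℝ} (hα : 0 < α) (hαβ : α ≤ β) (hσ : 0 ≤ σ) :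
    (β + σ) / (α + σ) ≤ β / α := by
  rw [div_le_div_iff₀ (by linarith) hα]
  nlinarith

/-- The CG rate `κ ↦ (√κ − 1)/(√κ + 1)` is monotone: a smaller condition number gives a smaller
(better) rate. [cite: Saad2003, §6.11.3 Theorem 6.29 eq. (6.128)] -/
theorem sqrtRate_mono {κ κ' : ℝ} (h : κ ≤ κ') :
    (Real.sqrt κ - 1) / (Real.sqrt κ + 1) ≤ (Real.sqrt κ' - 1) / (Real.sqrt κ' + 1) := by
  have hs := Real.sqrt_le_sqrt h
  have h1 : 0 < Real.sqrt κ + 1 := by positivity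
  have h2 : 0 < Real.sqrt κ' + 1 := by positivity
  rw [div_le_div_iff₀ h1 h2]
  nlinarith [hs, Real.sqrt_nonneg κ, Real.sqrt_nonneg κ']

/-- **The seed bound holds for every positively shifted system** (the rigorous, bound-level content
of "`σ = 0` corresponds usually to the system with the slowest convergence" / "the shifted
polynomial converges better than the original polynomial with a rate growing with `σ`"): if `A` is
symmetric positive definite with spectrum in `[α, β]`, `0 < α < β`, `κ = β/α`, and `σ ≥ 0`, then the
`m`-th Galerkin (CG) iterate `x'` of `(A + σ) x = b` from `x₀` satisfies
`‖x'_* − x'‖_{A+σ} ≤ 2((√κ − 1)/(√κ + 1))^m ‖x'_* − x₀‖_{A+σ}` — Saad's (6.128) for the shifted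
matrix (spectrum in `[α+σ, β+σ]`, condition number `≤ κ`) weakened to the SEED's `κ`.  About the
a-priori bounds only; that the actual factors obey `0 < ζ^σ_m ≤ 1` is not claimed here.
[cite: Jegerlehner1996, §2.1 and §3.1 ("σ = 0 corresponds usually to the system with the slowest
convergence"); Saad2003, §6.11.3 Theorem 6.29 eq. (6.128)] -/
theorem IsCGIterate.aNorm_le_geometric_of_shift {A : Matrix ι ι ℝ} (hA : A.PosDef) {σ : ℝ}
    (hσ : 0 ≤ σ) {b x₀ xs' x' : ι → ℝ} {m : ℕ} (hx' : IsCGIterate (A + σ • 1) b x₀ m x')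
    (hb : (A + σ • 1) *ᵥ xs' = b) {α β : ℝ} (hα : 0 < α) (hαβ : α < β)
    (hspec : ∀ i, hA.1.eigenvalues i ∈ Set.Icc α β) :
    aNorm (A + σ • 1) (xs' - x') ≤
      2 * ((Real.sqrt (β / α) - 1) / (Real.sqrt (β / α) + 1)) ^ m * aNorm (A + σ • 1) (xs' - x₀) := by
  have hAσ : (A + σ • (1 : Matrix ι ι ℝ)).PosDef := posDef_add_smul_one hA hσ
  have hspec' : ∀ i, hAσ.1.eigenvalues i ∈ Set.Icc (α + σ) (β + σ) :=
    eigenvalues_add_smul_one_mem_Icc hA.1 hspec hAσ.1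
  have h := hx'.aNorm_le_geometric hAσ hb (by linarith) (by linarith) hspec'
  refine h.trans (mul_le_mul_of_nonneg_right ?_ (aNorm_nonneg _ _))
  refine mul_le_mul_of_nonneg_left (pow_le_pow_left₀ ?_ ?_ m) (by norm_num)
  · have hκ : 1 ≤ Real.sqrt ((β + σ) / (α + σ)) := by
      rw [show (1 : ℝ) = Real.sqrt 1 by simp]
      exact Real.sqrt_le_sqrt ((one_le_div (by linarith)).mpr (by linarith))
    exact div_nonneg (by linarith) (by linarith)
  · exact sqrtRate_mono (div_add_le_div hα hαβ.le hσ)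

end ConjugateGradient

end Literature.Analysis.Matrix

end
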